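import Mathlib.RingTheory.Localization.FractionRing
import Mathlib.RingTheory.Localization.Ideal
import Mathlib.RingTheory.MvPolynomial.Localization
import Mathlib.Algebra.MvPolynomial.Basic
import Mathlib.Algebra.Polynomial.Eval.Coeff

/-!
# `PairwiseCurvedTilingsLC` (crux stmt-MatrixMultiplication-17883), line LonelyTranslates (c1) —
stub S2: evaluation kills the chart ideal

Support lemma for the (conditional) refutation skeleton
`Cruxes/PairwiseCurvedTilingsLC/Lines/LonelyTranslates.lean`, section "Sub-lemmas of
`stub_relGen`".  Pure commutative algebra (Mathlib only).

Notation: `R = K[u] = MvPolynomial (Fin e) K`, `F = Frac R`,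
`K[u, w] = MvPolynomial (Fin e ⊕ Fin k) K`, `R[w] = MvPolynomial (Fin k) R`,
`F[w] = MvPolynomial (Fin k) F`, and `toFw : K[u, w] →ₐ[K] F[w]` the canonical map
(`u_i ↦ u_i / 1`, `w_j ↦ w_j`).  The statement `stub_eval_eq_zero_of_mem_span`: if
every coefficient of the image in `F[w][s]` of a polynomial `Q ∈ K[u, w][s]` lies in the ideal of
`F[w]` generated by the images of `D_1, …, D_k ∈ K[u, w]`, then there is `b ∈ R ∖ 0` such that
`Q(x, ·) = 0 ∈ K[s]` for every `K`-point `x` of `{D = 0}` with `b(u(x)) ≠ 0` (`u(x) = x ∘ inl`).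

Proof.  `toFw` factors as `K[u, w] → R[w] → F[w]` (`u_i ↦ C u_i`, `w_j ↦ w_j`, then coefficientwise
`R → F`; `evalOfMemSpan_aeval_eq_map_aeval`), and `F[w]` is the localization of `R[w]` at the image
of `R ∖ 0` (`MvPolynomial.isLocalization`).  By `IsLocalization.algebraMap_mem_map_algebraMap_iff`,
an element of `R[w]` whose image lies in the extension to `F[w]` of an ideal `I ⊆ R[w]` is
multiplied into `I` by some `C r`, `r ∈ R ∖ 0` (`evalOfMemSpan_exists_C_mul_mem_span`; no
injectivity is needed).  Take for `b` the product of these denominators over the finitely many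
nonzero coefficients `Q_i` of `Q`, and evaluate the memberships `C r_i · Q_i ∈ (D_1, …, D_k) R[w]`
at `x` (`evalOfMemSpan_eval₂Hom_aeval`): `r_i(u(x)) · Q_i(x) = 0` with `r_i(u(x)) ≠ 0`.
-/

set_option linter.dupNamespace false  -- `Summit.<S>.<S>.…` is the mandated namespace

namespace Summit.MatrixMultiplication.MatrixMultiplication.Theorems.PairwiseCurvedTilingsLC.Negative

section Helpers

variable {K : Type*} [CommRing K] {σ τ : Type*}

/-- Factorisation of `toFw` through the iterated polynomial ring.  For any `K[u]`-algebra `F`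
(`K[u] = MvPolynomial σ K`, compatible `K`-algebra structures), the `K`-algebra map
`K[u, w] → F[w]`, `u_i ↦ C (algebraMap u_i)`, `w_j ↦ w_j`, is the coefficientwise map
`K[u][w] → F[w]` after the map `K[u, w] → K[u][w]`, `u_i ↦ C u_i`, `w_j ↦ w_j`. -/
theorem evalOfMemSpan_aeval_eq_map_aeval (F : Type*) [CommRing F]
    [Algebra (MvPolynomial σ K) F] [Algebra K F] [IsScalarTower K (MvPolynomial σ K) F]
    (p : MvPolynomial (σ ⊕ τ) K) :
    MvPolynomial.aeval (Sum.elim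
        (fun i => MvPolynomial.C (algebraMap (MvPolynomial σ K) F (MvPolynomial.X i)))
        (fun j => (MvPolynomial.X j : MvPolynomial τ F))) p =
      MvPolynomial.map (algebraMap (MvPolynomial σ K) F)
        (MvPolynomial.aeval (Sum.elim (fun i => MvPolynomial.C (MvPolynomial.X i))
          (fun j => (MvPolynomial.X j : MvPolynomial τ (MvPolynomial σ K)))) p) := by
  induction p using MvPolynomial.induction_on with
  | C a =>
    rw [MvPolynomial.algHom_C, MvPolynomial.algHom_C, MvPolynomial.algebraMap_apply,
      MvPolynomial.algebraMap_apply, MvPolynomial.map_C,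
      ← IsScalarTower.algebraMap_apply K (MvPolynomial σ K) F a]
  | add p q hp hq => simp only [map_add, hp, hq]
  | mul_X p n hp =>
    simp only [map_mul, hp, MvPolynomial.aeval_X]
    cases n <;> simp

/-- Evaluation commutes with the passage to the iterated ring: evaluating the image of
`p ∈ K[u, w]` in `K[u][w]` (`u_i ↦ C u_i`, `w_j ↦ w_j`) — coefficients at `u(x) = x ∘ inl`,
variables at `w(x) = x ∘ inr` — gives the value of `p` at `x`. -/
theorem evalOfMemSpan_eval₂Hom_aeval (x : σ ⊕ τ → K) (p : MvPolynomial (σ ⊕ τ) K) :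
    MvPolynomial.eval₂Hom (MvPolynomial.eval (x ∘ Sum.inl)) (x ∘ Sum.inr)
        (MvPolynomial.aeval (Sum.elim (fun i => MvPolynomial.C (MvPolynomial.X i))
          (fun j => (MvPolynomial.X j : MvPolynomial τ (MvPolynomial σ K)))) p) =
      MvPolynomial.eval x p := by
  induction p using MvPolynomial.induction_on with
  | C a =>
    simp only [MvPolynomial.algHom_C, MvPolynomial.algebraMap_apply, MvPolynomial.algebraMap_eq,
      MvPolynomial.eval₂Hom_C, MvPolynomial.eval_C]
  | add p q hp hq => simp only [map_add, hp, hq]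
  | mul_X p n hp =>
    simp only [map_mul, hp, MvPolynomial.aeval_X]
    cases n <;> simp

/-- **Contraction from the generic fibre clears a denominator.**  Let `K[u] = MvPolynomial σ K`
have fraction ring `F` and let `D_j, q ∈ K[u, w]`.  If the image of `q` in `F[w]` lies in the ideal
of `F[w]` generated by the images of the `D_j`, then for some non-zero-divisor `r ∈ K[u]` the
element `C r · q'` lies in the ideal of `K[u][w]` generated by the `D_j'`, where `'` is the image in
`K[u][w]`.  (`F[w]` is the localization of `K[u][w]` at `C (K[u] ∖ 0)`,
`MvPolynomial.isLocalization`; then `IsLocalization.algebraMap_mem_map_algebraMap_iff`.) -/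
theorem evalOfMemSpan_exists_C_mul_mem_span (F : Type*) [CommRing F]
    [Algebra (MvPolynomial σ K) F] [Algebra K F] [IsScalarTower K (MvPolynomial σ K) F]
    [IsFractionRing (MvPolynomial σ K) F] {ι : Type*} (D : ι → MvPolynomial (σ ⊕ τ) K)
    (q : MvPolynomial (σ ⊕ τ) K)
    (hq : MvPolynomial.aeval (Sum.elim
        (fun i => MvPolynomial.C (algebraMap (MvPolynomial σ K) F (MvPolynomial.X i)))
        (fun j => (MvPolynomial.X j : MvPolynomial τ F))) q ∈
      Ideal.span (Set.range fun j => MvPolynomial.aeval (Sum.elim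
        (fun i => MvPolynomial.C (algebraMap (MvPolynomial σ K) F (MvPolynomial.X i)))
        (fun j => (MvPolynomial.X j : MvPolynomial τ F))) (D j))) :
    ∃ r : MvPolynomial σ K, r ∈ nonZeroDivisors (MvPolynomial σ K) ∧
      MvPolynomial.C r * MvPolynomial.aeval (Sum.elim (fun i => MvPolynomial.C (MvPolynomial.X i))
          (fun j => (MvPolynomial.X j : MvPolynomial τ (MvPolynomial σ K)))) q ∈
        Ideal.span (Set.range fun j => MvPolynomial.aeval (Sum.elim
          (fun i => MvPolynomial.C (MvPolynomial.X i))
          (fun j => (MvPolynomial.X j : MvPolynomial τ (MvPolynomial σ K)))) (D j)) := by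
  -- `F[w]` as a `K[u][w]`-algebra (coefficientwise; Mathlib's non-instance `algebraMvPolynomial`)
  -- is the localization of `K[u][w]` at `C (K[u] ∖ 0)`
  letI : Algebra (MvPolynomial τ (MvPolynomial σ K)) (MvPolynomial τ F) :=
    MvPolynomial.algebraMvPolynomial
  haveI : IsLocalization ((nonZeroDivisors (MvPolynomial σ K)).map
      (MvPolynomial.C : MvPolynomial σ K →+* MvPolynomial τ (MvPolynomial σ K)))
      (MvPolynomial τ F) :=
    MvPolynomial.isLocalization _ _
  have halg : ∀ p, algebraMap (MvPolynomial τ (MvPolynomial σ K)) (MvPolynomial τ F) p =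
      MvPolynomial.map (algebraMap (MvPolynomial σ K) F) p := fun _ => rfl
  set I : Ideal (MvPolynomial τ (MvPolynomial σ K)) := Ideal.span (Set.range fun j =>
    MvPolynomial.aeval (Sum.elim (fun i => MvPolynomial.C (MvPolynomial.X i))
      (fun j => (MvPolynomial.X j : MvPolynomial τ (MvPolynomial σ K)))) (D j)) with hI
  -- the ideal of `F[w]` generated by the images of the `D_j` is the extension of `I`
  have hmap : Ideal.span (Set.range fun j => MvPolynomial.aeval (Sum.elim
        (fun i => MvPolynomial.C (algebraMap (MvPolynomial σ K) F (MvPolynomial.X i)))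
        (fun j => (MvPolynomial.X j : MvPolynomial τ F))) (D j)) =
      I.map (algebraMap (MvPolynomial τ (MvPolynomial σ K)) (MvPolynomial τ F)) := by
    rw [hI, Ideal.map_span, ← Set.range_comp]
    refine congrArg (fun f => Ideal.span (Set.range f)) (funext fun j => ?_)
    rw [Function.comp_apply, halg]
    exact evalOfMemSpan_aeval_eq_map_aeval F (D j)
  rw [hmap, evalOfMemSpan_aeval_eq_map_aeval F q, ← halg,
    IsLocalization.algebraMap_mem_map_algebraMap_iff
      ((nonZeroDivisors (MvPolynomial σ K)).map
        (MvPolynomial.C : MvPolynomial σ K →+* MvPolynomial τ (MvPolynomial σ K)))] at hq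
  obtain ⟨m, hm, hmq⟩ := hq
  obtain ⟨r, hr, rfl⟩ := Submonoid.mem_map.1 hm
  exact ⟨r, hr, hmq⟩

end Helpers

/-- STUB S2 of line LonelyTranslates (c1) (evaluation kills the chart ideal): if every
coefficient of the image of `Q ∈ K[u,w][s]` in `F[w][s]` lies in the ideal generated by the images
of `D_1, …, D_k`, then off a hypersurface `b(u) = 0` (`b ≠ 0`; the denominators of the coefficients
of the combination), `Q(x, ·)` vanishes identically at every `K`-point `x` of `{D = 0}`. -/
theorem stub_eval_eq_zero_of_mem_span {K : Type} [Field K] {e k : ℕ}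
    (D : Fin k → MvPolynomial (Fin e ⊕ Fin k) K) (Q : Polynomial (MvPolynomial (Fin e ⊕ Fin k) K))
    (hQ : ∀ i, (Q.map (MvPolynomial.aeval (Sum.elim
          (fun i => MvPolynomial.C (algebraMap (MvPolynomial (Fin e) K)
            (FractionRing (MvPolynomial (Fin e) K)) (MvPolynomial.X i)))
          (fun j => MvPolynomial.X j)) :
            MvPolynomial (Fin e ⊕ Fin k) K →ₐ[K]
              MvPolynomial (Fin k) (FractionRing (MvPolynomial (Fin e) K))).toRingHom).coeff i ∈
        Ideal.span (Set.range fun j => MvPolynomial.aeval (Sum.elim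
          (fun i => MvPolynomial.C (algebraMap (MvPolynomial (Fin e) K)
            (FractionRing (MvPolynomial (Fin e) K)) (MvPolynomial.X i)))
          (fun j => MvPolynomial.X j)) (D j))) :
    ∃ b : MvPolynomial (Fin e) K, b ≠ 0 ∧ ∀ x : Fin e ⊕ Fin k → K,
      (∀ j, MvPolynomial.eval x (D j) = 0) → MvPolynomial.eval (x ∘ Sum.inl) b ≠ 0 →
        Q.map (MvPolynomial.eval x) = 0 := by
  classical
  -- a denominator `r_i ∈ K[u] ∖ 0` for each coefficient `Q_i` of `Q`:
  -- `C r_i · Q_i' ∈ (D_1', …, D_k') K[u][w]`, where `'` is the image in `K[u][w]`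
  have key : ∀ i, ∃ r : MvPolynomial (Fin e) K, r ∈ nonZeroDivisors (MvPolynomial (Fin e) K) ∧
      MvPolynomial.C r * MvPolynomial.aeval (Sum.elim (fun i => MvPolynomial.C (MvPolynomial.X i))
          (fun j => (MvPolynomial.X j : MvPolynomial (Fin k) (MvPolynomial (Fin e) K))))
            (Q.coeff i) ∈
        Ideal.span (Set.range fun j => MvPolynomial.aeval (Sum.elim
          (fun i => MvPolynomial.C (MvPolynomial.X i))
          (fun j => (MvPolynomial.X j : MvPolynomial (Fin k) (MvPolynomial (Fin e) K)))) (D j)) :=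
    fun i => evalOfMemSpan_exists_C_mul_mem_span (FractionRing (MvPolynomial (Fin e) K)) D
      (Q.coeff i) (by have h := hQ i; rwa [Polynomial.coeff_map] at h)
  choose r hr hrI using key
  refine ⟨∏ i ∈ Q.support, r i, nonZeroDivisors.ne_zero (Submonoid.prod_mem _ fun i _ => hr i),
    fun x hD hb => ?_⟩
  rw [map_prod] at hb
  -- the ideal `(D_1', …, D_k') K[u][w]` dies under the evaluation `K[u][w] → K` at `x`
  have hI : Ideal.span (Set.range fun j => MvPolynomial.aeval (Sum.elim
      (fun i => MvPolynomial.C (MvPolynomial.X i))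
      (fun j => (MvPolynomial.X j : MvPolynomial (Fin k) (MvPolynomial (Fin e) K)))) (D j)) ≤
      RingHom.ker (MvPolynomial.eval₂Hom (MvPolynomial.eval (x ∘ Sum.inl)) (x ∘ Sum.inr)) := by
    rw [Ideal.span_le]
    rintro _ ⟨j, rfl⟩
    rw [SetLike.mem_coe, RingHom.mem_ker, evalOfMemSpan_eval₂Hom_aeval, hD j]
  ext i
  rw [Polynomial.coeff_map, Polynomial.coeff_zero]
  by_cases hi : i ∈ Q.support
  · have h1 := hI (hrI i)
    rw [RingHom.mem_ker, map_mul, MvPolynomial.eval₂Hom_C, evalOfMemSpan_eval₂Hom_aeval] at h1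
    exact (mul_eq_zero.1 h1).resolve_left (Finset.prod_ne_zero_iff.1 hb i hi)
  · rw [Polynomial.notMem_support_iff.1 hi, map_zero]

end Summit.MatrixMultiplication.MatrixMultiplication.Theorems.PairwiseCurvedTilingsLC.Negative
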